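import Summits.QuantumFields.YangMills.Theorems.VirialFluxGapAssemblyPointPackage
import Summits.QuantumFields.YangMills.Theorems.VirialFluxGapFixGenericParametersSix
import HarnessLib

/-!
# Route `VirialFluxGap` ∕ the (P) road to ⟨24196⟩: ASSEMBLY OF THE PATCHED EULER FIELD, PART I♯ — the GENERIC POINT PACKAGE with SIX kernel vectors
# (δ-rerun S2 of ✓`VirialFluxGapAssemblyPointPackage` §3; LEAD ym-line-sfw-p2 g97 allocation ➊, 2026-08-31)

★★ `generic_point_package_sharp` — ✓`generic_point_package` VERBATIM except: a divergence target `η ∈ (0,1]` is a parameter, the deficit window is the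
`η²`-window `t₀ ≤ η²·t_G` (which implies the old one, so the det-localiser, positivity, drive and resolvent-size conclusions are unchanged), and the
divergence conclusion reads `div c¹ ≤ #ι − 6 + η/4` (✓`fix_generic_divergence_upper_window_six`, S1b; six orthonormal kernel vectors, LEAD's (E1)
✓`fix_generic_divergence_upper_six`) instead of `#ι − 4 + 1/4`.  The det floor hypothesis `hδ` stays on the old window `t_G`.

HONEST LABEL: a pointwise helper of the rerun; no field is assembled here; nothing about ⟨24196⟩ ∕ ⟨24194⟩ ∕ ⟨24197⟩ (OPEN) is proved; item of record ⟨24085⟩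
SubOctaveBounded aside ∕ untouched; the Yang–Mills mass gap is NOT proved; no summit is proved by a line.  THEOREMS ONLY (0 `def`, 0 `sorry`), standard axioms.
Seat ym-line-fcl-p3 g47 (cell ym-idea-1, free hands), `--supports stmt-QuantumFields-24196`.  References: [cite: Luscher1983, §2]; [folklore].
-/

set_option autoImplicit false

noncomputable section

open scoped Matrix BigOperators ContDiff Topology Quaternion
open MeasureTheory Set Matrix
open Literature.MathematicalPhysics.QuantumFieldTheory hiding SU2
open Literature.MathematicalPhysics.QuantumLattice
open Literature.MathematicalPhysics.QuantumFieldTheory.SUNBakryEmery (expSU coe_expSU matTop)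

namespace Summit.QuantumFields.YangMills.Theorems.VirialFluxGap.FrameHessian

open Summit.QuantumFields.YangMills.Theorems.FemtoTransferGap
open Summit.QuantumFields.YangMills.Theorems.FemtoTransferGap.TT
open Summit.QuantumFields.YangMills.Theorems.FemtoTransferGap.TwoLattice
open Summit.QuantumFields.YangMills.Theorems.FemtoTransferGap.TwoLattice.Flat
open Summit.QuantumFields.YangMills.Theorems.VirialFluxGap.RingDeficit
open Summit.QuantumFields.YangMills.Theorems.VirialFluxGap.FrameDerivative
open Summit.QuantumFields.YangMills.Theorems.VirialFluxGap.ResolventField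
open Summit.QuantumFields.YangMills.Theorems.VirialFluxGap.RegularValley
open Summit.QuantumFields.YangMills.Theorems.VirialFluxGap.FixFrame
open Summit.QuantumFields.YangMills.Theorems.VirialFluxGap.RegCutoff
open Summit.QuantumFields.YangMills.Theorems.VirialFluxGap.FieldPatching
open Summit.QuantumFields.YangMills.Theorems.VirialFluxGap.FixField
open Summit.QuantumFields.YangMills.Theorems.VirialFluxGap.PatchingBudget

variable {L : ℕ} [NeZero L]

open scoped Matrix.Norms.Frobenius

/-- ★★ **The generic point package with SIX kernel vectors and divergence target `η`.**  Fix `ρ′ ∈ (0,1]`, `K ≥ 0`, `ε ∈ (0,1]`, the trilinear bound `hK3`, a gradient–energy constant `C₂`, a window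
`0 < t₀ ≤ t_G` and a floor `2δ′ ≤ det(H + λ⋆1)²` on the closed generic window (`λ⋆ = ερ′²/(3·1032960L⁸)`).  Then at every `ρ′`-regular point `x`
of `X_fix` with `F_fix x ≤ t₀`: the det-localiser `θ = 1 − ψ(det²/δ′)` equals `1` with vanishing frame derivatives, the resolvent drive is signed and
`≥ 2(1−ε)F`, the divergence of `c¹ = 2·resolventCoeff fixFrameStd λ⋆ θ` is `≤ #ι − 6 + η/4` (window `t₀ ≤ η²·t_G`), and `|A⁻¹g|² ≤ #ι·2C₂L⁴·t₀/(λ⋆/2)²`. [cite: Luscher1983, §2] -/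
theorem generic_point_package_sharp [DecidableEq (FixVar L × Fin 3)] {ρ' K ε t₀ δ' C₂ η : ℝ} (hρ' : 0 < ρ') (hρ'1 : ρ' ≤ 1) (hK : 0 ≤ K) (hε : 0 < ε) (hε1 : ε ≤ 1)
    (hη : 0 < η) (hη1 : η ≤ 1)
    (hK3 : ∀ (Y₁ Y₂ Y₃ : ((Fin (2 * L - 1 + 1) × Edge 3 L) ⊕ Site 3 L) → Matrix (Fin 2) (Fin 2) ℂ) (b₁ b₂ b₃ : ℝ), 0 ≤ b₁ → 0 ≤ b₂ → 0 ≤ b₃ →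
      (∀ w, ‖Y₁ w‖ ≤ b₁) → (∀ w, ‖Y₂ w‖ ≤ b₂) → (∀ w, ‖Y₃ w‖ ≤ b₃) → ∀ Q : ((Fin (2 * L - 1 + 1) → GaugeConfig 3 L SU2) × (Site 3 L → SU2)),
      |frameD Y₁ (frameD Y₂ (frameD Y₃ (ringPoly L))) (ringCoord L Q)| ≤ K * b₁ * b₂ * b₃)
    (hC₂0 : 0 ≤ C₂)
    (hC₂ : ∀ (Q : ((Fin (2 * L - 1 + 1) → GaugeConfig 3 L SU2) × (Site 3 L → SU2)))
      (Y : ((Fin (2 * L - 1 + 1) × Edge 3 L) ⊕ Site 3 L) → Matrix (Fin 2) (Fin 2) ℂ), (∀ w, (Y w)ᴴ = -Y w) → (∀ w, (Y w).trace = 0) →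
      ∀ b : ℝ, 0 ≤ b → (∀ w, ‖Y w‖ ≤ b) →
      (frameD Y (ringPoly L) (ringCoord L Q)) ^ 2 ≤ 2 * (C₂ * (L : ℝ) ^ 4 * b ^ 2) * ringDeficit L (fun _ => false) Q)
    (ht₀G : t₀ ≤ η ^ 2 * (ρ' ^ 2 * ε ^ 3 * (ρ' ^ 2 / (1032960 * (L : ℝ) ^ 8)) ^ 2 /
          (1032960 * 10000 * (L : ℝ) ^ 8 * (K + 1) ^ 2 * (Fintype.card (FixVar L × Fin 3) : ℝ) ^ 5)))
    (hδ' : 0 < δ')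
    (hδ : ∀ x : (OffIdx L → SU2) × ((Fin (2 * L - 1) → GaugeConfig 3 L SU2) × (Site 3 L → SU2)),
      ((∃ k : Fin 3, ρ' ^ 2 ≤ 1 - (su2Quat (wrapReps ((Fin.cons (glue x.1) x.2.1 : Fin (2 * L - 1 + 1) → GaugeConfig 3 L SU2) 0) k)).re ^ 2) ∨
          ρ' ^ 2 ≤ 1 - (su2Quat (x.2.2 0)).re ^ 2) →
      ringDeficit L (fun _ => false) ((Fin.cons (glue x.1) x.2.1 : Fin (2 * L - 1 + 1) → GaugeConfig 3 L SU2), x.2.2) ≤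
        ρ' ^ 2 * ε ^ 3 * (ρ' ^ 2 / (1032960 * (L : ℝ) ^ 8)) ^ 2 /
          (1032960 * 10000 * (L : ℝ) ^ 8 * (K + 1) ^ 2 * (Fintype.card (FixVar L × Fin 3) : ℝ) ^ 5) →
      2 * δ' ≤ ((frameHess (L := L) fixFrameStd (ringCoord L ((Fin.cons (glue x.1) x.2.1 : Fin (2 * L - 1 + 1) → GaugeConfig 3 L SU2), x.2.2)) +
        (ε * (ρ' ^ 2 / (1032960 * (L : ℝ) ^ 8)) / 3) • (1 : Matrix (FixVar L × Fin 3) (FixVar L × Fin 3) ℝ)).det) ^ 2)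
    (x : (OffIdx L → SU2) × ((Fin (2 * L - 1) → GaugeConfig 3 L SU2) × (Site 3 L → SU2)))
    (hreg : (∃ k : Fin 3, ρ' ^ 2 ≤ 1 - (su2Quat (wrapReps ((Fin.cons (glue x.1) x.2.1 : Fin (2 * L - 1 + 1) → GaugeConfig 3 L SU2) 0) k)).re ^ 2) ∨
          ρ' ^ 2 ≤ 1 - (su2Quat (x.2.2 0)).re ^ 2)
    (hF : ringDeficit L (fun _ => false) ((Fin.cons (glue x.1) x.2.1 : Fin (2 * L - 1 + 1) → GaugeConfig 3 L SU2), x.2.2) ≤ t₀) :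
    (1 - deficitStep (((frameHess (L := L) fixFrameStd (ringCoord L ((Fin.cons (glue x.1) x.2.1 : Fin (2 * L - 1 + 1) → GaugeConfig 3 L SU2), x.2.2)) +
        (ε * (ρ' ^ 2 / (1032960 * (L : ℝ) ^ 8)) / 3) • (1 : Matrix (FixVar L × Fin 3) (FixVar L × Fin 3) ℝ)).det) ^ 2 / δ') = 1) ∧
    (∀ va : FixVar L × Fin 3, frameD (fixFrameStd va)
        (fun M' : (Fin (2 * L - 1 + 1) → Edge 3 L → Matrix (Fin 2) (Fin 2) ℂ) × (Site 3 L → Matrix (Fin 2) (Fin 2) ℂ) =>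
          1 - deficitStep (((frameHess (L := L) fixFrameStd M' +
            (ε * (ρ' ^ 2 / (1032960 * (L : ℝ) ^ 8)) / 3) • (1 : Matrix (FixVar L × Fin 3) (FixVar L × Fin 3) ℝ)).det) ^ 2 / δ'))
        (ringCoord L ((Fin.cons (glue x.1) x.2.1 : Fin (2 * L - 1 + 1) → GaugeConfig 3 L SU2), x.2.2)) = 0) ∧
    0 ≤ frameGrad (L := L) fixFrameStd (ringCoord L ((Fin.cons (glue x.1) x.2.1 : Fin (2 * L - 1 + 1) → GaugeConfig 3 L SU2), x.2.2)) ⬝ᵥ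
        ((frameHess (L := L) fixFrameStd (ringCoord L ((Fin.cons (glue x.1) x.2.1 : Fin (2 * L - 1 + 1) → GaugeConfig 3 L SU2), x.2.2)) +
          (ε * (ρ' ^ 2 / (1032960 * (L : ℝ) ^ 8)) / 3) • (1 : Matrix (FixVar L × Fin 3) (FixVar L × Fin 3) ℝ))⁻¹ *ᵥ
          frameGrad (L := L) fixFrameStd (ringCoord L ((Fin.cons (glue x.1) x.2.1 : Fin (2 * L - 1 + 1) → GaugeConfig 3 L SU2), x.2.2))) ∧
    (1 - ε) * ringDeficit L (fun _ => false) ((Fin.cons (glue x.1) x.2.1 : Fin (2 * L - 1 + 1) → GaugeConfig 3 L SU2), x.2.2) ≤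
      (1 / 2) * (frameGrad (L := L) fixFrameStd (ringCoord L ((Fin.cons (glue x.1) x.2.1 : Fin (2 * L - 1 + 1) → GaugeConfig 3 L SU2), x.2.2)) ⬝ᵥ
        ((frameHess (L := L) fixFrameStd (ringCoord L ((Fin.cons (glue x.1) x.2.1 : Fin (2 * L - 1 + 1) → GaugeConfig 3 L SU2), x.2.2)) +
          (ε * (ρ' ^ 2 / (1032960 * (L : ℝ) ^ 8)) / 3) • (1 : Matrix (FixVar L × Fin 3) (FixVar L × Fin 3) ℝ))⁻¹ *ᵥ
          frameGrad (L := L) fixFrameStd (ringCoord L ((Fin.cons (glue x.1) x.2.1 : Fin (2 * L - 1 + 1) → GaugeConfig 3 L SU2), x.2.2)))) ∧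
    (∑ va : FixVar L × Fin 3, frameD (fixFrameStd va)
        (fun M' : (Fin (2 * L - 1 + 1) → Edge 3 L → Matrix (Fin 2) (Fin 2) ℂ) × (Site 3 L → Matrix (Fin 2) (Fin 2) ℂ) =>
          2 * resolventCoeff (L := L) fixFrameStd ((ε * (ρ' ^ 2 / (1032960 * (L : ℝ) ^ 8)) / 3))
            (fun M'' : (Fin (2 * L - 1 + 1) → Edge 3 L → Matrix (Fin 2) (Fin 2) ℂ) × (Site 3 L → Matrix (Fin 2) (Fin 2) ℂ) =>
              1 - deficitStep (((frameHess (L := L) fixFrameStd M'' +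
                (ε * (ρ' ^ 2 / (1032960 * (L : ℝ) ^ 8)) / 3) • (1 : Matrix (FixVar L × Fin 3) (FixVar L × Fin 3) ℝ)).det) ^ 2 / δ')) va M')
        (ringCoord L ((Fin.cons (glue x.1) x.2.1 : Fin (2 * L - 1 + 1) → GaugeConfig 3 L SU2), x.2.2)) ≤
      (Fintype.card (FixVar L × Fin 3) : ℝ) - 6 + η / 4) ∧
    ((frameHess (L := L) fixFrameStd (ringCoord L ((Fin.cons (glue x.1) x.2.1 : Fin (2 * L - 1 + 1) → GaugeConfig 3 L SU2), x.2.2)) +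
          (ε * (ρ' ^ 2 / (1032960 * (L : ℝ) ^ 8)) / 3) • (1 : Matrix (FixVar L × Fin 3) (FixVar L × Fin 3) ℝ))⁻¹ *ᵥ
          frameGrad (L := L) fixFrameStd (ringCoord L ((Fin.cons (glue x.1) x.2.1 : Fin (2 * L - 1 + 1) → GaugeConfig 3 L SU2), x.2.2))) ⬝ᵥ
      ((frameHess (L := L) fixFrameStd (ringCoord L ((Fin.cons (glue x.1) x.2.1 : Fin (2 * L - 1 + 1) → GaugeConfig 3 L SU2), x.2.2)) +
          (ε * (ρ' ^ 2 / (1032960 * (L : ℝ) ^ 8)) / 3) • (1 : Matrix (FixVar L × Fin 3) (FixVar L × Fin 3) ℝ))⁻¹ *ᵥ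
          frameGrad (L := L) fixFrameStd (ringCoord L ((Fin.cons (glue x.1) x.2.1 : Fin (2 * L - 1 + 1) → GaugeConfig 3 L SU2), x.2.2))) ≤
      (Fintype.card (FixVar L × Fin 3) : ℝ) * (2 * (C₂ * (L : ℝ) ^ 4)) * t₀ / ((ε * (ρ' ^ 2 / (1032960 * (L : ℝ) ^ 8)) / 3) / 2) ^ 2 := by
  classical
  set P : (Fin (2 * L - 1 + 1) → GaugeConfig 3 L SU2) × (Site 3 L → SU2) :=
    ((Fin.cons (glue x.1) x.2.1 : Fin (2 * L - 1 + 1) → GaugeConfig 3 L SU2), x.2.2) with hPdef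
  set lam : ℝ := (ε * (ρ' ^ 2 / (1032960 * (L : ℝ) ^ 8)) / 3) with hlam
  have hPx : ∀ e : Edge 3 L, treeEdge e = true → P.1 0 e = 1 := fixEmbed_tree x
  have hL0 : (0 : ℝ) < L := by exact_mod_cast NeZero.pos L
  have htη : ringDeficit L (fun _ => false) P ≤ η ^ 2 * (ρ' ^ 2 * ε ^ 3 * (ρ' ^ 2 / (1032960 * (L : ℝ) ^ 8)) ^ 2 /
      (1032960 * 10000 * (L : ℝ) ^ 8 * (K + 1) ^ 2 * (Fintype.card (FixVar L × Fin 3) : ℝ) ^ 5)) := hF.trans ht₀G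
  have htG0 : 0 ≤ ρ' ^ 2 * ε ^ 3 * (ρ' ^ 2 / (1032960 * (L : ℝ) ^ 8)) ^ 2 /
      (1032960 * 10000 * (L : ℝ) ^ 8 * (K + 1) ^ 2 * (Fintype.card (FixVar L × Fin 3) : ℝ) ^ 5) := by positivity
  have hη2 : η ^ 2 ≤ 1 := pow_le_one₀ hη.le hη1
  have ht : ringDeficit L (fun _ => false) P ≤ ρ' ^ 2 * ε ^ 3 * (ρ' ^ 2 / (1032960 * (L : ℝ) ^ 8)) ^ 2 /
      (1032960 * 10000 * (L : ℝ) ^ 8 * (K + 1) ^ 2 * (Fintype.card (FixVar L × Fin 3) : ℝ) ^ 5) :=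
    htη.trans ((mul_le_mul_of_nonneg_right hη2 htG0).trans (by rw [one_mul]))
  have hlam2 : 0 < lam / 2 := by rw [hlam]; positivity
  -- the window facts of the generic region
  have hunit := fix_generic_isUnit_det_window P hPx hρ' hρ'1 hreg hK hε hε1 hK3 ht
  have hdrive := fix_generic_drive_lower_window P hPx hρ' hρ'1 hreg hK hε hε1 hK3 ht
  have hdivE2 := fix_generic_divergence_upper_window_six P hPx hρ' hρ'1 hreg hK hε hε1 hη hη1 hK3 htη
  have hnonneg := fix_generic_drive_nonneg_window P hPx hρ' hρ'1 hreg hK hε hε1 hK3 ht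
  have hrsq := fix_generic_resolvent_sq_le_window P hPx hρ' hρ'1 hreg hK hε hε1 hK3 ht
  have hgsq := frameGrad_dot_self_le (L := L) P hC₂
  -- the localiser is invisible here
  have hdet2 : 2 * δ' ≤ ((frameHess (L := L) fixFrameStd (ringCoord L P) + lam • (1 : Matrix (FixVar L × Fin 3) (FixVar L × Fin 3) ℝ)).det) ^ 2 :=
    hδ x hreg ht
  have hθ1 : 1 - deficitStep (((frameHess (L := L) fixFrameStd (ringCoord L P) + lam • (1 : Matrix (FixVar L × Fin 3) (FixVar L × Fin 3) ℝ)).det) ^ 2 / δ') = 1 :=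
    detLocaliser_eq_one fixFrameStd lam hδ' hdet2
  have hθD : ∀ va : FixVar L × Fin 3, frameD (fixFrameStd va)
      (fun M' : (Fin (2 * L - 1 + 1) → Edge 3 L → Matrix (Fin 2) (Fin 2) ℂ) × (Site 3 L → Matrix (Fin 2) (Fin 2) ℂ) =>
        1 - deficitStep (((frameHess (L := L) fixFrameStd M' + lam • (1 : Matrix (FixVar L × Fin 3) (FixVar L × Fin 3) ℝ)).det) ^ 2 / δ'))
      (ringCoord L P) = 0 := fun va => frameD_detLocaliser_eq_zero fixFrameStd lam hδ' hdet2 _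
  refine ⟨hθ1, hθD, hnonneg, hdrive, ?_, ?_⟩
  · -- divergence of `c¹`
    rw [sum_frameD_two_mul_resolventCoeff fixFrameStd_conjTranspose fixFrameStd_trace lam (contDiff_detLocaliser fixFrameStd lam δ')
      (tsupport_detLocaliser_subset fixFrameStd lam hδ') P hunit.ne_zero hθ1 hθD]
    linarith
  · -- size of the resolvent vector
    have hF0 : 0 ≤ ringDeficit L (fun _ => false) P := ringDeficit_nonneg _ _
    have h1 : frameGrad (L := L) fixFrameStd (ringCoord L P) ⬝ᵥ frameGrad (L := L) fixFrameStd (ringCoord L P) ≤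
        (Fintype.card (FixVar L × Fin 3) : ℝ) * (2 * (C₂ * (L : ℝ) ^ 4)) * t₀ :=
      hgsq.trans (mul_le_mul_of_nonneg_left hF (by positivity))
    rw [le_div_iff₀ (by positivity), mul_comm]
    exact hrsq.trans h1

end Summit.QuantumFields.YangMills.Theorems.VirialFluxGap.FrameHessian

end
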